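import Summits.QuantumFields.YangMills.Theorems.BalabanUVNodesN15KingModelPotential
import Summits.QuantumFields.YangMills.Theorems.BalabanUVNodesN15KingModelPerturbedDeriv

/-!
# Route «BalabanUVNodes» (K4 «SpineRates»), node N15 = NE2 — THE KING-MODEL RUNG, part 8d: THE ENVELOPE IDENTITY — King's effective Laplacian
# IN A POTENTIAL `Δ^{(k)}_w = a_k − a_k²N^dQ(A₀ + w)⁻¹Qᵀ` as an object, and the PROOF that part 8a's `E(w)` IS its first variation:
# `d∕dt|₀ Δ^{(k)}_{tw}(b,b′) = N^{−(d+1)} Σ_x ℋ_k(x,b)·w(x)·ℋ_k(x,b′)`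

Cell `pub-ymgap`, Track A (D-0062), seat `pub-ymgap-dag-n15-d` (R134 seat, strategy s3, gen 6).  `bears_on: R4∕N15`; `--supports` the K3‴ item
`SpineGivenEndpointR13` (stmt-QuantumFields-19912).  COUNT-NEUTRAL; definition lane (three objects `fineOpPot`, `effLaplacianPot`, `kingLevelPot` are
data; every theorem is kernel calculus).  Imports part 8a (`potLevel`, `potTower`) and part 7c (`hasDerivAt_inv_affine_apply`).

WHY THIS FILE.  Part 8a DEFINED the perturbation `E(w)(b,b′) = N^{−(d+1)}Σ_x ℋ(x,b)w(x)ℋ(x,b′)` «modelled on the envelope formula» and its HONEST SCOPE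
said the dressed operator and the envelope identity were not constructed.  THIS FILE constructs and proves them, on EVERY torus (no volume
restriction): §1 **`fineOpPot`** `A₀(w) = c(−Δ) + m² + aQᵀQ-term + diag(w)` (King's `fineOp`, the ψ-quadratic part of the block-spin energy (2.13), WITH a
fine-lattice potential `w` added) and **`effLaplacianPot`** `Δ_eff(w) = a·1 − a²N^d·Q A₀(w)⁻¹Qᵀ` (King's (2.14)∕(4.5) formula with `A₀ ↦ A₀(w)`: the
quadratic form of the Gaussian block integral of the fine action with the potential); `effLaplacianPot_zero` (= `King1986.Torus.effLaplacian`),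
`fineOpPot_smul` (affine along rays), `coercive_fineOp_add_smul_diagonal` (`A₀ ± t·diag w ≥ m²∕2` for `|t|·sup|w| ≤ m²∕2`, from `fineOp_coercive`);
§2 the closed form of King's minimiser at a point source `ψ_{δ_b}(z) = aN^d(A₀⁻¹Qᵀ)(z,b)` (`minimiser_single_apply`), the symmetry `(A₀⁻¹)ᵀ = A₀⁻¹`
(`fineOp_inv_transpose`), the matrix form of the sandwich `N^{−d}Σ_z ψ_b(z)w(z)ψ_{b′}(z) = a²N^d(Q A₀⁻¹ diag(w) A₀⁻¹ Qᵀ)(b,b′)` (`sandwich_minimiser_eq`),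
and **`hasDerivAt_effLaplacianPot_apply`**: for `a, c ≥ 0`, `m² > 0`, EVERY potential `w` and all unit sites,
`HasDerivAt (t ↦ Δ_eff(t·w)(b,b′)) (N^{−d}Σ_z ψ_{δ_b}(z)·w(z)·ψ_{δ_{b′}}(z)) 0` — the Hellmann–Feynman ∕ envelope formula for the Gaussian minimum
`⟨φ,Δ^{(k)}φ⟩ = min_ψ energy` (tree `effLaplacian_eq_energy`), PROVED by the resolvent derivative `d∕dt(A₀ + t·D)⁻¹ = −A₀⁻¹DA₀⁻¹` (part 7c's
`hasDerivAt_inv_affine_apply` = King's (4.39)–(4.40) at `t = 0`); §3 King BY NAME: **`kingLevelPot a m² L M k w`** = `Δ^{(k)}_w` (`effLaplacianPot` at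
`N = L^k`, `a_k = aK a L k`, `c = N²`; `kingLevelPot_zero = kingLevel`), **`hasDerivAt_kingLevelPot_apply`**: `d∕dt|₀ Δ^{(k)}_{tw}(b,b′) = potLevel …
(L^k) k w b b′` — PART 8a's PERTURBATION IS THE FIRST VARIATION OF KING'S EFFECTIVE LAPLACIAN IN THE POTENTIAL (`k ≥ 1`, `L ≥ 2`, `a, m² > 0`, any
torus), and **`hasDerivAt_kingTowerPot_apply`**: the same for the ℕ-towers (`kingTower + t·potTower v` is the first-order Taylor polynomial of the
dressed tower `j ↦ Δ^{(max j 1)}_{t·v}`).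

HONEST FRAMING ∕ LIMITS.  King's `A = 0` SCALAR block-spin construction (periodic b.c., flat blocks, `m² > 0`); the potential is a real multiplication
operator on the fine torus (NOT a gauge field); first order only — parts 8b∕8c's letters and `NE2PlusUnit` concern the LINEARISED dressed tower
`Δ^{(k)} + E(v)`, not `Δ^{(k)}_v` itself (the second-order remainder is not estimated here); nothing here is Bałaban's `Δ^{(k)}(U) − Δ^{(k)}(1)`,
`C^{(k)}(Λ; U)`, `G(U)` (η-differences NOT PRINTED); NOT the carriers of record (NODE 00); NOT a node discharge; typed 28∕28, discharged count
untouched; one finite torus programme at fixed ε — NOT ℝ⁴ ∕ infinite volume ∕ OS ∕ mass gap ∕ Clay.  Locators only: [King1986] = C. King, CMP **102**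
(1986) 649–677: (2.4)–(2.6) p. 652, (2.13)–(2.15) p. 653 (energy, `Δ^{(k)} = a_k − a_k²Q_kG_kQ_k^*`, minimiser `ℋ_k = a_kG_kQ_k^*`), (4.5) p. 670,
(4.39) p. 674, (4.40) p. 675 (resolvent derivative).
-/

noncomputable section

open scoped BigOperators Matrix
open Finset

namespace Summit.QuantumFields.YangMills.BalabanUVNodes.N15.KingModel

open Literature.MathematicalPhysics.QuantumFieldTheory.Balaban1983to89 hiding blockOf
open Literature.MathematicalPhysics.QuantumFieldTheory.Balaban1983to89.QGQInverse (Coercive)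
open Literature.MathematicalPhysics.QuantumFieldTheory.Balaban1983to89.B5Prop11Plancherel (Tor fine)
open Literature.MathematicalPhysics.QuantumFieldTheory.King1986 (aK aK_pos)
open Literature.MathematicalPhysics.QuantumFieldTheory.King1986.Torus (minimiser fineOp fineOp_coercive fineOp_transpose effLaplacian Qmat)

variable {dd : ℕ}

/-! ## §1 King's fine-lattice operator and effective Laplacian IN A POTENTIAL -/

section EnvelopeDefs

variable (N : ℕ) [NeZero N] (U : Fin dd → ℕ) [∀ μ, NeZero (U μ)] (a c m2 : ℝ)

/-- **KING'S FINE-LATTICE OPERATOR IN A POTENTIAL** `A₀(w) = c(−Δ) + m² + w + aQᵀQ-term` on the fine torus `Π ℤ∕(N·U_μ)`: the tree's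
`King1986.Torus.fineOp` (the ψ-quadratic part of the block-spin energy (2.13)) plus the multiplication operator by the potential `w`.
[cite: King1986, (2.4)–(2.6) p.652, (2.13)–(2.14) p.653 (the energy; A = 0)] -/
def fineOpPot (w : Tor (fine N U) → ℝ) : Matrix (Tor (fine N U)) (Tor (fine N U)) ℝ :=
  fineOp N U a c m2 + Matrix.diagonal w

/-- **KING'S EFFECTIVE LAPLACIAN IN A POTENTIAL** `Δ_eff(w) = a·1 − a²N^d·Q A₀(w)⁻¹ Qᵀ` — the tree's `effLaplacian` with `A₀ ↦ A₀(w)` (the quadratic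
form of the Gaussian block integral of the fine action WITH the potential `N^{−d}⟨ψ, wψ⟩` added).  TOTALITY NOTE: `A₀(w)⁻¹` is `Matrix.inv`, so for a
potential outside the invertibility band (e.g. `sup|w| ≥ m²` with `A₀(w)` singular) this definition carries the junk value `a·1` of the zero inverse; every
theorem below evaluates it inside the coercive band `|t|·sup|w| < m²∕2`, where `A₀(w)` IS invertible. [cite: King1986, (2.13)–(2.14) p.653, (4.5) p.670 (A = 0)] -/
def effLaplacianPot (w : Tor (fine N U) → ℝ) : Matrix (Tor U) (Tor U) ℝ :=
  a • (1 : Matrix (Tor U) (Tor U) ℝ) - (a ^ 2 * (N : ℝ) ^ dd) • (Qmat N U * (fineOpPot N U a c m2 w)⁻¹ * (Qmat N U)ᵀ)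

variable {N U a c m2}

/-- At the zero potential the dressed fine operator is King's. [folklore] -/
theorem fineOpPot_zero : fineOpPot N U a c m2 (fun _ => 0) = fineOp N U a c m2 := by
  rw [fineOpPot, Matrix.diagonal_zero, add_zero]

/-- At the zero potential the dressed effective Laplacian is King's `Δ^{(k)}`. [folklore] -/
theorem effLaplacianPot_zero : effLaplacianPot N U a c m2 (fun _ => 0) = effLaplacian N U a c m2 := by
  rw [effLaplacianPot, fineOpPot_zero]
  rfl

/-- Along the ray `t ↦ t·w` the dressed fine operator is affine: `A₀(t·w) = A₀ + t·diag(w)`. [folklore] -/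
theorem fineOpPot_smul (t : ℝ) (w : Tor (fine N U) → ℝ) :
    fineOpPot N U a c m2 (t • w) = fineOp N U a c m2 + t • Matrix.diagonal w := by
  rw [fineOpPot, ← Matrix.diagonal_smul]

/-- Coercivity of `A₀ + t·diag(w)` for `|t|·sup|w| ≤ m²∕2`: `≥ m²∕2` (King's `A₀ ≥ m²`, `fineOp_coercive`). [folklore] -/
theorem coercive_fineOp_add_smul_diagonal (ha : 0 ≤ a) (hc : 0 ≤ c) (m2 : ℝ) {w : Tor (fine N U) → ℝ} {w₀ t : ℝ}
    (hw : ∀ x, |w x| ≤ w₀) (ht : |t| * w₀ ≤ m2 / 2) :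
    Coercive (fineOp N U a c m2 + t • Matrix.diagonal w) (m2 / 2) := by
  intro x
  have h0 := fineOp_coercive N U m2 ha hc x
  rw [Matrix.add_mulVec, dotProduct_add, Matrix.smul_mulVec, dotProduct_smul, smul_eq_mul]
  have hdv : x ⬝ᵥ (Matrix.diagonal w *ᵥ x) = ∑ i, w i * (x i * x i) := by
    unfold dotProduct
    exact sum_congr rfl fun i _ => by rw [Matrix.mulVec_diagonal]; ring
  rw [hdv]
  have hxx' : x ⬝ᵥ x = ∑ i, x i * x i := rfl
  have hdiag : |∑ i, w i * (x i * x i)| ≤ w₀ * (x ⬝ᵥ x) := by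
    rw [hxx']
    calc |∑ i, w i * (x i * x i)| ≤ ∑ i, |w i * (x i * x i)| := abs_sum_le_sum_abs _ _
      _ ≤ ∑ i, w₀ * (x i * x i) := sum_le_sum fun i _ => by
          rw [abs_mul, abs_mul_self]
          exact mul_le_mul_of_nonneg_right (hw i) (mul_self_nonneg _)
      _ = w₀ * ∑ i, x i * x i := by rw [mul_sum]
  have hxx : 0 ≤ x ⬝ᵥ x := Literature.LinearAlgebra.Matrix.dotProduct_self_nonneg_real x
  have h1 : -(|t| * w₀ * (x ⬝ᵥ x)) ≤ t * ∑ i, w i * (x i * x i) := by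
    have hb : |t * ∑ i, w i * (x i * x i)| ≤ |t| * (w₀ * (x ⬝ᵥ x)) := by
      rw [abs_mul]
      exact mul_le_mul_of_nonneg_left hdiag (abs_nonneg t)
    have := (abs_le.mp hb).1
    nlinarith
  nlinarith [mul_le_mul_of_nonneg_right ht hxx]

end EnvelopeDefs

/-! ## §2 The envelope identity: the first variation of the dressed effective Laplacian is the `ℋ w ℋ` sandwich -/

section Envelope

variable {N : ℕ} [NeZero N] {U : Fin dd → ℕ} [∀ μ, NeZero (U μ)] {a c m2 : ℝ}

/-- Entries of the sandwich `Q M Qᵀ` as a double sum. [folklore] -/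
theorem sandwich_apply (M : Matrix (Tor (fine N U)) (Tor (fine N U)) ℝ) (b b' : Tor U) :
    (Qmat N U * M * (Qmat N U)ᵀ) b b' = ∑ y, ∑ x, Qmat N U b x * M x y * Qmat N U b' y := by
  rw [Matrix.mul_apply]
  refine sum_congr rfl fun y _ => ?_
  rw [Matrix.mul_apply, Matrix.transpose_apply, sum_mul]

/-- King's minimiser at a point source in closed form: `ψ_{δ_b}(z) = aN^d·(A₀⁻¹Qᵀ)(z, b)` — the tree's `King1986.Torus.minimiser` (the minimiser of
the block-spin energy (2.13); the printed (2.15) is that energy's normalisation factor, not the minimiser). [cite: King1986, (2.13) p.653 (the energy whose minimiser this is; A = 0)] -/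
theorem minimiser_single_apply (b : Tor U) (z : Tor (fine N U)) :
    minimiser N U a c m2 (Pi.single b 1) z = (a * (N : ℝ) ^ dd) * ((fineOp N U a c m2)⁻¹ * (Qmat N U)ᵀ) z b := by
  show ((a * (N : ℝ) ^ dd) • ((fineOp N U a c m2)⁻¹ *ᵥ ((Qmat N U)ᵀ *ᵥ Pi.single b 1))) z = _
  rw [Matrix.mulVec_single_one, Pi.smul_apply, smul_eq_mul, Matrix.mul_apply]
  rfl

/-- King's fine operator has a symmetric inverse. [folklore] -/
theorem fineOp_inv_transpose : ((fineOp N U a c m2)⁻¹)ᵀ = (fineOp N U a c m2)⁻¹ := by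
  rw [Matrix.transpose_nonsing_inv, fineOp_transpose]

/-- The `ℋ w ℋ` sandwich in matrix form: `N^{−d} Σ_z ψ_b(z) w(z) ψ_{b′}(z) = a²N^d·(Q A₀⁻¹ diag(w) A₀⁻¹ Qᵀ)(b, b′)`. [folklore] -/
theorem sandwich_minimiser_eq (w : Tor (fine N U) → ℝ) (b b' : Tor U) :
    (((N : ℕ) : ℝ) ^ dd)⁻¹ * ∑ z, minimiser N U a c m2 (Pi.single b 1) z * w z * minimiser N U a c m2 (Pi.single b' 1) z
      = (a ^ 2 * (N : ℝ) ^ dd) *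
        (Qmat N U * ((fineOp N U a c m2)⁻¹ * Matrix.diagonal w * (fineOp N U a c m2)⁻¹) * (Qmat N U)ᵀ) b b' := by
  set A := fineOp N U a c m2 with hA
  set Q := Qmat N U with hQ
  have hN : ((N : ℕ) : ℝ) ^ dd ≠ 0 := pow_ne_zero _ (Nat.cast_ne_zero.mpr (NeZero.ne N))
  -- the matrix `M = A⁻¹Qᵀ` and `Mᵀ D M`
  have hM : (Q * (A⁻¹ * Matrix.diagonal w * A⁻¹) * Qᵀ) b b' = ∑ z, (A⁻¹ * Qᵀ) z b * w z * (A⁻¹ * Qᵀ) z b' := by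
    have e : Q * (A⁻¹ * Matrix.diagonal w * A⁻¹) * Qᵀ = (A⁻¹ * Qᵀ)ᵀ * Matrix.diagonal w * (A⁻¹ * Qᵀ) := by
      rw [Matrix.transpose_mul, Matrix.transpose_transpose, fineOp_inv_transpose]
      simp only [Matrix.mul_assoc]
      rfl
    rw [e, Matrix.mul_apply]
    refine sum_congr rfl fun z _ => ?_
    rw [Matrix.mul_diagonal, Matrix.transpose_apply]
  rw [hM, mul_sum, mul_sum]
  refine sum_congr rfl fun z _ => ?_
  rw [minimiser_single_apply, minimiser_single_apply]
  field_simp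
  ring

/-- **THE ENVELOPE IDENTITY — KING'S EFFECTIVE LAPLACIAN IN A POTENTIAL, TO FIRST ORDER.**  For `a, c ≥ 0`, `m² > 0` and any potential `w` on
the fine torus, every entry of the dressed effective Laplacian `t ↦ Δ_eff(t·w)(b, b′)` is differentiable at `t = 0` with derivative
`N^{−d} Σ_z ψ_{δ_b}(z)·w(z)·ψ_{δ_{b′}}(z)` (`ψ_φ` = King's minimiser): the first variation of the block-spin effective quadratic form along a
potential is the expectation of the potential in the minimiser (Hellmann–Feynman ∕ envelope formula for the Gaussian minimum
`⟨φ, Δ^{(k)}φ⟩ = min_ψ energy`).  Mechanism: `Δ_eff(t·w) = a − a²N^d·Q(A₀ + t·diag w)⁻¹Qᵀ`, part 7c's `hasDerivAt_inv_affine_apply` (King's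
(4.39)–(4.40) resolvent derivative) at `t = 0` with the coercivity `A₀ ± δ·diag w ≥ m²∕2`, and `sandwich_minimiser_eq`. [cite: King1986, (2.13)–(2.15) p.653, (4.39) p.674, (4.40) p.675] -/
theorem hasDerivAt_effLaplacianPot_apply (ha : 0 ≤ a) (hc : 0 ≤ c) (hm : 0 < m2) (w : Tor (fine N U) → ℝ) (b b' : Tor U) :
    HasDerivAt (fun t : ℝ => effLaplacianPot N U a c m2 (t • w) b b')
      ((((N : ℕ) : ℝ) ^ dd)⁻¹ * ∑ z, minimiser N U a c m2 (Pi.single b 1) z * w z * minimiser N U a c m2 (Pi.single b' 1) z) 0 := by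
  set A := fineOp N U a c m2 with hA
  set D := Matrix.diagonal w with hD
  set Q := Qmat N U with hQ
  -- a bound for the potential and a step
  set w₀ : ℝ := ∑ x, |w x| + 1 with hw₀
  have hw0 : 0 < w₀ := by positivity
  have hw : ∀ x, |w x| ≤ w₀ := fun x => by
    have h : |w x| ≤ ∑ y, |w y| := Finset.single_le_sum (f := fun y => |w y|) (fun _ _ => abs_nonneg _) (Finset.mem_univ x)
    linarith
  set δ : ℝ := m2 / (2 * w₀) with hδ
  have hδ0 : 0 < δ := by positivity
  have hδw : |δ| * w₀ ≤ m2 / 2 := by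
    rw [abs_of_pos hδ0, hδ]
    exact le_of_eq (by field_simp)
  have hp : Coercive (A + (0 + δ) • D) (m2 / 2) := by
    rw [zero_add]; exact coercive_fineOp_add_smul_diagonal ha hc m2 hw hδw
  have hmn : Coercive (A + (0 - δ) • D) (m2 / 2) := by
    rw [zero_sub]; exact coercive_fineOp_add_smul_diagonal ha hc m2 hw (by rwa [abs_neg])
  -- entrywise derivative of the inverse at `t = 0`
  have hinv : ∀ x y, HasDerivAt (fun u : ℝ => (A + u • D)⁻¹ x y) (-((A⁻¹ * D * A⁻¹) x y)) 0 := by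
    intro x y
    have h := hasDerivAt_inv_affine_apply (half_pos hm) hδ0 hp hmn x y
    simpa only [zero_smul, add_zero] using h
  -- the entry as an explicit function of `t`
  have hfun : (fun t : ℝ => effLaplacianPot N U a c m2 (t • w) b b')
      = fun t : ℝ => a * (1 : Matrix (Tor U) (Tor U) ℝ) b b' - (a ^ 2 * (N : ℝ) ^ dd) * ∑ y, ∑ x, Q b x * (A + t • D)⁻¹ x y * Q b' y := by
    funext t
    rw [effLaplacianPot, fineOpPot_smul, Matrix.sub_apply, Matrix.smul_apply, Matrix.smul_apply, smul_eq_mul, smul_eq_mul, sandwich_apply]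
  rw [hfun]
  have hsum : HasDerivAt (fun t : ℝ => ∑ y, ∑ x, Q b x * (A + t • D)⁻¹ x y * Q b' y)
      (∑ y, ∑ x, Q b x * (-((A⁻¹ * D * A⁻¹) x y)) * Q b' y) 0 := by
    apply HasDerivAt.fun_sum
    intro y _
    apply HasDerivAt.fun_sum
    intro x _
    exact ((hinv x y).const_mul (Q b x)).mul_const (Q b' y)
  have hall := (hsum.const_mul (a ^ 2 * (N : ℝ) ^ dd)).const_sub (a * (1 : Matrix (Tor U) (Tor U) ℝ) b b')
  refine hall.congr_deriv ?_
  -- the value: `−(a²N^d)·Σ Q(−A⁻¹DA⁻¹)Q = a²N^d·(Q A⁻¹DA⁻¹ Qᵀ)(b,b′)` = the `ℋwℋ` sandwich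
  rw [sandwich_minimiser_eq, sandwich_apply]
  simp only [mul_neg, neg_mul, sum_neg_distrib, neg_neg]
  rfl

end Envelope

/-! ## §3 King by name: `Δ^{(k)}_w`, and part 8a's perturbation IS its first variation -/

section KingPot

variable {d : ℕ} (a m2 : ℝ) (L : ℕ) [NeZero L] (M : Fin (d + 1) → ℕ) [∀ μ, NeZero (M μ)]

/-- **KING'S LEVEL-`k` EFFECTIVE LAPLACIAN IN A FINE-LATTICE POTENTIAL** `Δ^{(k)}_w = a_k − a_k²N^dQ(A₀ + w)⁻¹Qᵀ` on the unit lattice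
`Π_μ ℤ∕(LM_μ)` (`N = L^k` fine points per unit side, `a_k = aK a L k`, `c = N²` as in part 3's `kingLevel`). [cite: King1986, (2.13)–(2.14) p.653, (4.5) p.670 (w = 0)] -/
def kingLevelPot (k : ℕ) (w : Tor (fine (L ^ k) (fine L M)) → ℝ) : Matrix (Tor (fine L M)) (Tor (fine L M)) ℝ :=
  effLaplacianPot (L ^ k) (fine L M) (aK a L k) (((L ^ k : ℕ) : ℝ) ^ 2) m2 w

variable {a m2 L M}

/-- At the zero potential `Δ^{(k)}_0 = Δ^{(k)}` (part 3's `kingLevel`). [folklore] -/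
theorem kingLevelPot_zero (k : ℕ) : kingLevelPot a m2 L M k (fun _ => 0) = kingLevel a m2 L M k :=
  effLaplacianPot_zero

/-- **PART 8a's PERTURBATION IS THE FIRST VARIATION OF KING'S EFFECTIVE LAPLACIAN IN THE POTENTIAL**: for `L ≥ 2`, `a, m² > 0`, `k ≥ 1`, every
potential `w` on the level-`k` fine torus of ANY torus `Π ℤ∕(LM_μ)` and all unit sites,
`HasDerivAt (t ↦ Δ^{(k)}_{t·w}(b, b′)) (potLevel L (fine L M) a m² (L^k) k w b b′) 0`. [cite: King1986, (2.13)–(2.15) p.653, (4.39) p.674, (4.40) p.675] -/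
theorem hasDerivAt_kingLevelPot_apply (hL : 2 ≤ L) (ha : 0 < a) (hm : 0 < m2) {k : ℕ} (hk : 1 ≤ k)
    (w : Tor (fine (L ^ k) (fine L M)) → ℝ) (b b' : Tor (fine L M)) :
    HasDerivAt (fun t : ℝ => kingLevelPot a m2 L M k (t • w) b b') (potLevel L (fine L M) a m2 (L ^ k) k w b b') 0 := by
  have hLr : (1 : ℝ) < L := by exact_mod_cast (by omega : 1 < L)
  exact hasDerivAt_effLaplacianPot_apply (aK_pos ha hLr hk).le (by positivity) hm w b b'

/-- **THE DRESSED ℕ-TOWER TO FIRST ORDER**: for a potential tower `v`, at every level `j` and all unit sites,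
`HasDerivAt (t ↦ Δ^{(max j 1)}_{t·v_{L^{max j 1}}}(b, b′)) (potTower L (fine L M) a m² v j b b′) 0` — `kingTower j + t·potTower v j` is the first-order
Taylor polynomial at `t = 0` of King's tower dressed by the potential tower. [cite: King1986, (2.13)–(2.14) p.653] -/
theorem hasDerivAt_kingTowerPot_apply (hL : 2 ≤ L) (ha : 0 < a) (hm : 0 < m2) (v : ∀ N : ℕ, Tor (fine N (fine L M)) → ℝ) (j : ℕ)
    (b b' : Tor (fine L M)) :
    HasDerivAt (fun t : ℝ => kingLevelPot a m2 L M (max j 1) (t • v (L ^ max j 1)) b b') (potTower L (fine L M) a m2 v j b b') 0 :=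
  hasDerivAt_kingLevelPot_apply hL ha hm (le_max_right j 1) (v (L ^ max j 1)) b b'

end KingPot

end Summit.QuantumFields.YangMills.BalabanUVNodes.N15.KingModel

end
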